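import Summits.SmoothPoincare4.SmoothPoincare4.Theorems.EntropyRungCompactShrinkerGapEinsteinEndgame
import Summits.SmoothPoincare4.SmoothPoincare4.Theses.EntropyRung
import Literature.Geometry.Riemannian.HamiltonPCOClassificationKillingHopf
import Literature.AlgebraicTopology.FundamentalGroup.SphereSimplyConnected
import HarnessLib

/-!
# The Einstein door of crux `EntropyRung.CompactShrinkerGap` WITHOUT Hamilton's PIC sphere theorem
(line `cgy-variance-pivot`, skeleton v15.2, tenth lead; registered helpers
`helper_einsteinEndgameKillingHopf`, `helper_einsteinDoorReductionKillingHopf`)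

Crux stmt-SmoothPoincare4-10870: a closed `M ≃ₕ S⁴` carrying a normalised gradient shrinker `Ric + Hess f = g/2`,
`R + |∇f|² = f`, of Gaussian mass `∫ e^{-f} dV > 32π²√π e^{-3/2}` is diffeomorphic to `S⁴`.

Its EINSTEIN corner (`Hess f ≡ 0`, i.e. `Ric = g/2`) was landed as `stub_einsteinEndgame`
(`EntropyRungCompactShrinkerGapEinsteinEndgame.lean`, p121858) under TWO named facts: Gursky's Einstein gap on
homotopy 4-spheres (`gursky_einstein_homotopySphere_four`: `W ≡ 0` or `Vol ≤ 8π²/λ²`) and Hamilton's PIC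
sphere theorem (`hamilton_pic_sphere_four`, a deep Ricci-flow-with-surgery theorem), the latter used only to
recognise a compact simply connected 4-manifold of constant positive sectional curvature as `S⁴`. That
recognition is the Killing–Hopf theorem, which is now PROVED in the tree in quotient form
(`Literature.Geometry.Riemannian.killingHopf_quotient_four`, over `KillingHopfPositive.lean`), together with the
classification of free orthogonal quotients of even spheres
(`Literature.Topology.FourManifolds.nonempty_diffeomorph_or_isRealProjectiveSpace_of_orthogonal_quotient`: `S⁴` or
`ℝP⁴`) and `π₁(ℝP⁴) ≠ 1` (`IsRealProjectiveSpace.not_simplyConnectedSpace`). So the Einstein door needs ONE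
named fact, not two:

* `helper_einsteinEndgameKillingHopf` — `gursky_einstein_homotopySphere_four →` (crux data with `Hess f ≡ 0`
  `⇒ M ≃ₘ S⁴`): `Ric = ½g`; Gursky: constant sectional curvature `1/6` or `Vol ≤ 32π²`; the second alternative
  contradicts the landed volume floor `Vol > 32π²√π e^{1/2}` (p71839); in the first, Killing–Hopf makes `M` a free
  orthogonal quotient of the round `S⁴`, hence `S⁴` or `ℝP⁴`, and `M ≃ₕ S⁴` is simply connected.
* `helper_einsteinDoorReductionKillingHopf` — `gursky_einstein_homotopySphere_four →` (registered STUB 26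
  `stub_denseShrinkerIsEinstein`: crux data `⇒ Hess f ≡ 0`) `→ EntropyRung.CompactShrinkerGap`: the PIC-free twin
  of `helper_einsteinDoorReduction` (p128550).

No Theses statement is concluded; the open content (STUB 26, the Cao–Hamilton–Ilmanen gap question on homotopy
4-spheres) is untouched. No definition, no new named fact.

References: M. J. Gursky, Math. Ann. 318 (2000) 417–431, Thm. 1; J. M. Lee, Introduction to Riemannian Manifolds
(2018), Thm. 12.4, Cor. 12.5 (Killing–Hopf); A. Hatcher, Algebraic Topology, Ex. 1.43; H.-D. Cao, R. S. Hamilton,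
T. Ilmanen, arXiv:math/0404165, §4.
-/

noncomputable section

-- the registered namespace `Summit.SmoothPoincare4.SmoothPoincare4.Theorems` repeats a component (summit = sub-problem)
set_option linter.dupNamespace false

open MeasureTheory Set Function
open scoped Manifold ContDiff ENNReal Topology ContinuousMap

namespace Summit.SmoothPoincare4.SmoothPoincare4.Theorems

open Literature.Geometry Literature.Geometry.Lorentzian Literature.Geometry.Riemannian
  Literature.Geometry.Lorentzian.PseudoRiemannianMetric

/-- **The Einstein endgame under Gursky's gap alone (Killing–Hopf instead of Hamilton's PIC theorem).**
GIVEN `gursky_einstein_homotopySphere_four`: a smooth normalised gradient shrinker `Ric + Hess f = g/2`,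
`R + |∇f|² = f` on a closed `M ≃ₕ S⁴` with Gaussian mass `∫ e^{-f} dV > 32π²√π e^{-3/2}` and `Hess f ≡ 0`
lives on `M ≅ S⁴`. Proof: `Ric = ½ g`; `hasConstantSectionalCurvature_or_volume_le` (`λ = ½`) gives constant
sectional curvature `1/6` or `Vol ≤ ofReal (8π²/(½)²) = ofReal (32π²)`; the latter contradicts the volume floor
`32π²√π e^{1/2} < Vol` (`volume_floor_of_density`, `√π e^{1/2} > 1`); in the former `M` (simply connected, hence
connected) is a free orthogonal quotient of the round `S⁴` (`killingHopf_quotient_four`), i.e. `S⁴` or `ℝP⁴`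
(`nonempty_diffeomorph_or_isRealProjectiveSpace_of_orthogonal_quotient`), and `π₁(ℝP⁴) ≠ 1`.
[cite: Gursky2000, Theorem 1] [cite: Lee2018, Thm. 12.4 and Cor. 12.5] [cite: CaoHamiltonIlmanen2004, §4] -/
theorem helper_einsteinEndgameKillingHopf :
    Literature.Geometry.Riemannian.gursky_einstein_homotopySphere_four →
    ∀ (M : Type) [TopologicalSpace M] [T2Space M] [SecondCountableTopology M]
      [ChartedSpace (EuclideanSpace ℝ (Fin 4)) M] [IsManifold (𝓡 4) ∞ M] [CompactSpace M]
      [T3Space M] [MeasurableSpace M] [BorelSpace M],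
      M ≃ₕ Metric.sphere (0 : EuclideanSpace ℝ (Fin 5)) 1 →
    ∀ (g : Literature.Geometry.Lorentzian.PseudoRiemannianMetric (𝓡 4) ∞ (EuclideanSpace ℝ (Fin 4))
        (TangentSpace (𝓡 4) : M → Type _)) [g.HasLeviCivita] (f : M → ℝ) (hg : g.IsRiemannian),
      ContMDiff (𝓡 4) 𝓘(ℝ, ℝ) ∞ f →
      (∀ (x : M) (X Y : TangentSpace (𝓡 4) x),
        g.ricci x X Y + g.hessian f x X Y = (1 / 2 : ℝ) * g.val x X Y) →
      (∀ x : M, g.scalarCurvature x + g.gradSq f x = f x) →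
      ENNReal.ofReal (32 * Real.pi ^ 2 * Real.sqrt Real.pi * Real.exp (-(3 : ℝ) / 2)) <
        ∫⁻ x, ENNReal.ofReal (Real.exp (-f x))
          ∂(Literature.Geometry.Lorentzian.riemannianMeasure (g.toContMDiffRiemannianMetric hg)) →
      (∀ (x : M) (X Y : TangentSpace (𝓡 4) x), g.hessian f x X Y = 0) →
      Nonempty (M ≃ₘ⟮𝓡 4, 𝓡 4⟯ (Metric.sphere (0 : EuclideanSpace ℝ (Fin 5)) 1)) := by
  intro hG M _ _ _ _ _ _ _ _ _ e g _ f hg hf hsol hnorm hdens hE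
  -- `Hess f = 0` and the soliton equation: `Ric = ½ g`
  have hRic : ∀ (x : M) (X Y : TangentSpace (𝓡 4) x),
      g.ricci x X Y = (1 / 2 : ℝ) * g.val x X Y := fun x X Y ↦ by
    have h := hsol x X Y
    rwa [hE x X Y, add_zero] at h
  rcases gursky_einstein_homotopySphere_four.hasConstantSectionalCurvature_or_volume_le M g hG e hg
      (by norm_num : (0 : ℝ) < 1 / 2) hRic with hK | hvol
  · -- constant sectional curvature `1/6 > 0` on the simply connected closed `M`: Killing–Hopf
    haveI : SimplyConnectedSpace (Metric.sphere (0 : EuclideanSpace ℝ (Fin (4 + 1))) 1) :=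
      Literature.AlgebraicTopology.FundamentalGroup.simplyConnectedSpace_euclideanSphere 4
        (by norm_num)
    haveI : SimplyConnectedSpace M := e.simplyConnectedSpace_iff.2 inferInstance
    obtain ⟨Γ, q, hfree, hq, hsurj, hfib⟩ :=
      killingHopf_quotient_four M (1 / 2 / 3) g (by norm_num) hg hK
    rcases Literature.Topology.FourManifolds.nonempty_diffeomorph_or_isRealProjectiveSpace_of_orthogonal_quotient
        ⟨2, rfl⟩ hfree hq hsurj hfib with h | h
    · exact h
    · exact absurd ‹SimplyConnectedSpace M› (h.not_simplyConnectedSpace (by norm_num))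
  · exfalso
    have h32 : (8 * Real.pi ^ 2 / (1 / 2 : ℝ) ^ 2) = 32 * Real.pi ^ 2 := by ring
    rw [h32] at hvol
    -- the finite volume, read in `ℝ`, is at most `32π²` …
    have hle : (riemannianMeasure (g.toContMDiffRiemannianMetric hg) Set.univ).toReal ≤
        32 * Real.pi ^ 2 :=
      ENNReal.toReal_le_of_le_ofReal (by positivity) hvol
    -- … but exceeds `32π²√π e^{1/2} > 32π²` by the landed volume floor
    have hV := volume_floor_of_density M g f hg hf hsol hnorm hdens
    linarith [thirtyTwo_pi_sq_lt_thirtyTwo_pi_sq_mul_sqrt_pi_mul_exp_half]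

/-- **Door E, PIC-free**: Gursky's Einstein gap on homotopy 4-spheres `→` (registered STUB 26
`stub_denseShrinkerIsEinstein`: every dense normalised gradient shrinker on a closed homotopy 4-sphere has
`Hess f ≡ 0`) `→ EntropyRung.CompactShrinkerGap`, by `helper_einsteinEndgameKillingHopf`. The twin of
`helper_einsteinDoorReduction` (p128550) with Hamilton's PIC sphere theorem replaced by the proved Killing–Hopf
theorem. [cite: Gursky2000, Theorem 1] [cite: CaoHamiltonIlmanen2004, §4] -/
theorem helper_einsteinDoorReductionKillingHopf :
    Literature.Geometry.Riemannian.gursky_einstein_homotopySphere_four →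
    (∀ (M : Type) [TopologicalSpace M] [T2Space M] [SecondCountableTopology M]
      [ChartedSpace (EuclideanSpace ℝ (Fin 4)) M] [IsManifold (𝓡 4) ∞ M] [CompactSpace M]
      [T3Space M] [MeasurableSpace M] [BorelSpace M],
      M ≃ₕ Metric.sphere (0 : EuclideanSpace ℝ (Fin 5)) 1 →
    ∀ (g : Literature.Geometry.Lorentzian.PseudoRiemannianMetric (𝓡 4) ∞ (EuclideanSpace ℝ (Fin 4))
        (TangentSpace (𝓡 4) : M → Type _)) [g.HasLeviCivita] (f : M → ℝ) (hg : g.IsRiemannian),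
      ContMDiff (𝓡 4) 𝓘(ℝ, ℝ) ∞ f →
      (∀ (x : M) (X Y : TangentSpace (𝓡 4) x),
        g.ricci x X Y + g.hessian f x X Y = (1 / 2 : ℝ) * g.val x X Y) →
      (∀ x : M, g.scalarCurvature x + g.gradSq f x = f x) →
      ENNReal.ofReal (32 * Real.pi ^ 2 * Real.sqrt Real.pi * Real.exp (-(3 : ℝ) / 2)) <
        ∫⁻ x, ENNReal.ofReal (Real.exp (-f x))
          ∂(Literature.Geometry.Lorentzian.riemannianMeasure (g.toContMDiffRiemannianMetric hg)) →
      ∀ (x : M) (X Y : TangentSpace (𝓡 4) x), g.hessian f x X Y = 0) →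
    Summit.SmoothPoincare4.SmoothPoincare4.Theses.EntropyRung.CompactShrinkerGap := by
  intro hG h26 M _ _ _ _ _ _ _ _ _ e g _ f hg hf hsol hnorm hdens
  exact helper_einsteinEndgameKillingHopf hG M e g f hg hf hsol hnorm hdens
    (h26 M e g f hg hf hsol hnorm hdens)

end Summit.SmoothPoincare4.SmoothPoincare4.Theorems

end
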